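import Summits.AtomisticToContinuum.Crystallization.Theorems.OverbindingBudgetAffineLadder

/-!
# OverbindingBudget — LOCALISATION of the affine bridge B_aff onto good matter, and its NEAR / FAR regime split
# (decomp-a2c lens-4, generation 43, file B; critic row 637 «B″ layer-3 memo … as typed sub-pieces», re-targeted beneath B_aff)

Imports file A (`…Theorems.OverbindingBudgetAffineLadder`: `AffDeepReg`, `AffFramed`, F_aff, `AffineChartStraightening` = R_aff,
`HarmonicReductionAff` = B_aff) and restates nothing.  B_aff says `K_bent R → R_aff → ∃ ε₁ > 0, F_aff(ρ₁, ε₁, θ)`; F_aff is a floor on the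
WHOLE energy with a census price on aff-fine-deep scale-bad sites and rebates elsewhere.  This file types the two layers beneath it
(memo NODE-g43 §3–§4) over CLASS PAIR SUMS `pairSum S T y = ∑_{i ∈ S} ∑_{j ∈ T} V(|y i − y j|)` (`2·𝓔 = pairSum univ univ`, §1):

LAYER 3 — localisation onto GOOD matter `G = {aff-(ρ₁,ε₁,θ)-deep ∧ in-window [δ,2]}` (PROVED seam `harmonicReductionAff_of_defectPair_goodCore`):
    B_aff R ρ₁ θ  ⟸  DefectPairFloor  ∧  GoodCoreFloor R ρ₁ θ
* `DefectPairFloor` («D»): all pairs touching the bad class cost `≥ −C(δ)` per BAD site, provided the other sites have `nearestDist ≥ δ`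
  — Lennard-Jones STABILITY (Blanc–Lewin 2015 (10),(12): `𝓔 ≥ −C N` on the bad sub-configuration) plus packing of the `δ`-separated
  rest (`V ≥ −1/12`, `V ≥ −r⁻⁶/6`).  Registration-free; TRUE-type · ATTACKABLE-S/M.  [BlancLewin2015 §1.3; `lennardJones_stable`]
* `GoodCoreFloor R ρ₁ θ` («G»): `K_bent R → R_aff → ∃ ε₀ > 0 ∀ ε₁ ≤ ε₀ ∀ δ ∃ c > 0, C: ½·pairSum G G ≥ e⋆·#G + c·#(G ∩ scale-bad) − C·#Gᶜ`.
  Its zeroth order is FREE: `e⋆·#G ≤ ½·pairSum G G` for EVERY index set is the tree's chunk floor (`floor_add_shearGain_le`; §1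
  `card_mul_floor_le_half_pairSum`, PROVED) — the content of G is the LOCALISED census price `c` per scale-bad good site with only
  per-bad-site charges (no `N^{2/3}`, no gain rebates: the free surface of `y` is always wrapped in `≥ ρ₁` shells of non-deep sites).
  TRUE-type (not implied by the target: pairs touching bad sites may be arbitrarily repulsive) · ATTACKABLE-L.
LAYER 4 — the regime split of G (PROVED seam `goodCoreFloor_of_near_far`): `Near = G ∧ AffFramed ε₁ θ₀ ∧ ¬scale-bad` (own affine chart
`θ₀`-close to a similarity: ZERO census budget, harmonic treatment), `Far = G ∖ Near` (chart `≥ θ₀`-sheared or scale-bad: excess `≥ c_W θ₀²`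
or `≥ e_iso` per site by Cauchy–Born coercivity — crude treatment affordable):
    GoodCoreFloor R ρ₁ θ  ⟸  NearClusterFloor R ρ₁ θ θ₀ κ  ∧  FarAggregatePricing ρ₁ θ θ₀ κ
* `NearClusterFloor` («N»): `½·pairSum Near G ≥ e⋆·#Near − C·#Gᶜ − κ·#Far` — the harmonic expansion of each near site about ITS OWN affine
  chart (budgets, memo §4: zeroth order = energy per particle of an affine image of an ideal stacking `≥ e⋆` EXACTLY, no Taylor error; first
  order = boundary flux at transition bonds `O(ε₁)` → `κ`; internal (optical) first-order terms completed to squares against K; second order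
  `≥ 0` by K_bent along the interpolation path `Z_t` (no cubic term); pair tails variance-signed within the class, inter-grain exchange
  charged to the walls `C·#Gᶜ`, same-grain exchange beyond the Taylor range `≤ 0.27 ε₁^{3/2} ≤ κ` per far site).  TRUE-type · ATTACKABLE-L.
* `FarAggregatePricing` («Z»): `½·pairSum Far G ≥ (e⋆ + κ)·#Far + c·#(G ∩ scale-bad) − C·#Gᶜ` — per-site crude bound `W(A_x) − O(ε₁) − κ`
  with `W(A_x) − e⋆ ≥ c_W θ₀² ≫ κ + O(ε₁)` (far-by-shear) or `≥ e_iso ≈ 10⁻³` (scale-bad); needs the polytype affine equation of state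
  (CERT, layer-averaged: per-site layer fluctuation `±3·10⁻⁵` exceeds `c_W θ₀² ≈ 10⁻⁵`, but far regions are `≥ θ₀/ε₁ ≈ 10⁴` layers thick).
  TRUE-type · ATTACKABLE-M + CERT.
Record literals (memo §4.3): `R = 3` (K of record; hessian tail `0.16·C·gradForm` at `R = 3` is the one marginal constant — `R = 6` gives
`0.02`), `ρ₁ = 12` (patch rigidity: `ρ₁ ≥ R + 7`), `θ = 1/25`, `θ₀ = 10⁻³` (`≫ κ_hcp = 1.4·10⁻⁴`, `209·θ₀ ≲ μ/2`), `κ = 10⁻⁶` (`≥ 0.27 ε₁^{3/2} + C ε₁`), `ε₁ ≲ 10⁻⁷`.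
CONE LI (§5, PROVED): `K_bent R → R_aff → D → N → Z → AffMidAll ρ₁ θ → TBDSG` and the eleven-slot RDEF cone.
Why novel (vs g42's memo §5 and every OverbindingBudget node): the localisation is by INDEX CLASS with exact pair bookkeeping (no cut-offs,
no IMS, no smeared references — each of those loses a density-contrast-LINEAR amount against quadratic budgets, g43 dead ends), and the
near/far split puts the zero-budget matter exactly where the reference is Taylor-error-free.  No `sorry`; axioms standard.
-/

namespace Summit.AtomisticToContinuum.Crystallization.Theorems.OverbindingBudgetAffineLocalisation

open Filter Metric Set Topology
open scoped BigOperators Classical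
open Literature.MathematicalPhysics.StatisticalMechanics
open Literature.Geometry.DiscreteGeometry (IsChargeFree bondGraph nearestDist nearestDist_nonneg fccTwoShellPattern hcpTwoShellPattern)
open Summit.AtomisticToContinuum.Crystallization.Theses.OverbindingBudget (RobustDefectLimitWindows)
open Summit.AtomisticToContinuum.Crystallization.Theses.PricedLinkCensus (ChargedEnergyGap)
open Summit.AtomisticToContinuum.Crystallization.Theorems.OverbindingBudgetGradedBareness (CleanlessExcessT)
open Summit.AtomisticToContinuum.Crystallization.Theorems.OverbindingBudgetCoherentCut (CoherentResidual)
open Summit.AtomisticToContinuum.Crystallization.Theorems.OverbindingBudgetTwoShellShape (TwoShellShape)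
open Summit.AtomisticToContinuum.Crystallization.Theorems.OverbindingBudgetElasticSplitShear (shearGain floor_add_shearGain_le)
open Summit.AtomisticToContinuum.Crystallization.Theorems.OverbindingBudgetMisfitCensusStatements (Bad Short Long)
open Summit.AtomisticToContinuum.Crystallization.Theorems.OverbindingBudgetMisfitRegistration (Framed Reg DeepReg regScaleCount)
open Summit.AtomisticToContinuum.Crystallization.Theorems.OverbindingBudgetMisfitWindowStatements (InWindow offCount)
open Summit.AtomisticToContinuum.Crystallization.Theorems.OverbindingBudgetBalancedCensusStatements
open Summit.AtomisticToContinuum.Crystallization.Theorems.OverbindingBudgetBalancedCensusRecord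
open Summit.AtomisticToContinuum.Crystallization.Theorems.OverbindingBudgetHarmonicNormalForm
open Summit.AtomisticToContinuum.Crystallization.Theorems.OverbindingBudgetLocalHarmonicCertificate
open Summit.AtomisticToContinuum.Crystallization.Theorems.OverbindingBudgetAffineLadder

variable {N : ℕ}

local notation "E3" => EuclideanSpace ℝ (Fin 3)

/-! ## §1  Class pair sums and the good class -/

/-- `pairSum S T y = ∑_{i ∈ S} ∑_{j ∈ T} V_LJ(|y i − y j|)` — ordered pairs between two index classes (the diagonal contributes
`V_LJ(0) = 0`). -/
noncomputable def pairSum (S T : Finset (Fin N)) (y : Fin N → E3) : ℝ :=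
  ∑ i ∈ S, ∑ j ∈ T, lennardJones (dist (y i) (y j))

/-- `2·𝓔(y) = pairSum univ univ y`. [`two_mul_interactionEnergy_eq_sum_sum`, `lennardJones_zero`] -/
theorem two_mul_interactionEnergy_eq_pairSum (y : Fin N → E3) :
    2 * interactionEnergy lennardJones y = pairSum Finset.univ Finset.univ y :=
  two_mul_interactionEnergy_eq_sum_sum lennardJones lennardJones_zero y

/-- Splitting the first class along a sub-class and its complement. [this file] -/
theorem pairSum_univ_left (S T : Finset (Fin N)) (y : Fin N → E3) :
    pairSum Finset.univ T y = pairSum S T y + pairSum Sᶜ T y := by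
  unfold pairSum
  rw [Finset.sum_add_sum_compl]

/-- Splitting the second class along a sub-class and its complement. [this file] -/
theorem pairSum_univ_right (S T : Finset (Fin N)) (y : Fin N → E3) :
    pairSum S Finset.univ y = pairSum S T y + pairSum S Tᶜ y := by
  unfold pairSum
  rw [← Finset.sum_add_distrib]
  exact Finset.sum_congr rfl fun i _ => (Finset.sum_add_sum_compl T _).symm

/-- **The chunk floor, class form (PROVED): `#S · e⋆ ≤ ½ · pairSum S S y`** for every index class of an injective configuration —
the zeroth order of every floor below is free. [`floor_add_shearGain_le`] -/
theorem card_mul_floor_le_half_pairSum {y : Fin N → E3} (hy : Function.Injective y) (S : Finset (Fin N)) :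
    (S.card : ℝ) * (⨅ Q : PeriodicConfiguration 3, Q.energyPerParticle lennardJones) ≤ 1 / 2 * pairSum S S y := by
  have h := floor_add_shearGain_le (S.image y) norm_e0
  have hc : (S.image y).card = S.card := Finset.card_image_of_injective S hy
  have hs : ∑ a ∈ S.image y, ∑ b ∈ S.image y, lennardJones (dist a b) = pairSum S S y := by
    unfold pairSum
    rw [Finset.sum_image fun i _ j _ h => hy h]
    exact Finset.sum_congr rfl fun i _ => Finset.sum_image fun i _ j _ h => hy h
  rw [hc, hs] at h
  linarith [shearGain_nonneg e0 (S.image y)]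

/-- **The GOOD class** `G(ρ₁, ε₁, θ, δ)`: affinely `(ρ₁, ε₁, θ)`-deeply registered (gap `1/450`) and in the window `[δ, 2]`. -/
noncomputable def goodSet (ρ₁ ε₁ θ δ : ℝ) (y : Fin N → E3) : Finset (Fin N) :=
  Finset.univ.filter fun i => AffDeepReg ρ₁ ε₁ θ (1 / 450) y i ∧ InWindow δ 2 y i

/-- The scale-bad (SHORT/LONG at `a = 122/125`, `s = 0`) good sites — the sites the fine leaf prices. -/
noncomputable def goodScaleBadSet (ρ₁ ε₁ θ δ : ℝ) (y : Fin N → E3) : Finset (Fin N) :=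
  (goodSet ρ₁ ε₁ θ δ y).filter fun i =>
    Bad (122 / 125) 0 y i ∧ (Short (122 / 125) 0 y i ∨ Long (122 / 125) 0 y i)

/-- Good sites are `δ`-separated from everything. [this file] -/
theorem le_nearestDist_of_not_mem_compl_goodSet {ρ₁ ε₁ θ δ : ℝ} {y : Fin N → E3} {i : Fin N}
    (hi : i ∉ (goodSet ρ₁ ε₁ θ δ y)ᶜ) : δ ≤ nearestDist y i := by
  rw [Finset.mem_compl, not_not, goodSet, Finset.mem_filter] at hi
  exact hi.2.2.1

/-- Counting: the priced set of F_aff inside `#(G ∩ scale-bad) + #off`. [this file] -/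
theorem affRegScaleCount_le_goodScaleBad_add_off {ρ₁ ε₁ θ δ : ℝ} (y : Fin N → E3) :
    affRegScaleCount (122 / 125) 0 ρ₁ ε₁ θ (1 / 450) y ≤ (goodScaleBadSet ρ₁ ε₁ θ δ y).card + offCount δ 2 y := by
  simp only [affRegScaleCount, offCount, Nat.card_eq_fintype_card, Fintype.card_subtype]
  calc (Finset.univ.filter fun i => (Bad (122 / 125) 0 y i ∧ (Short (122 / 125) 0 y i ∨ Long (122 / 125) 0 y i)) ∧
          AffDeepReg ρ₁ ε₁ θ (1 / 450) y i).card
      ≤ (goodScaleBadSet ρ₁ ε₁ θ δ y ∪ Finset.univ.filter fun i => ¬ InWindow δ 2 y i).card := by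
        apply Finset.card_le_card
        intro i hi
        rw [Finset.mem_filter] at hi
        rw [Finset.mem_union, goodScaleBadSet, Finset.mem_filter, goodSet, Finset.mem_filter, Finset.mem_filter]
        by_cases hW : InWindow δ 2 y i
        · exact Or.inl ⟨⟨hi.1, hi.2.2, hW⟩, hi.2.1⟩
        · exact Or.inr ⟨hi.1, hW⟩
    _ ≤ _ := Finset.card_union_le _ _

/-- Counting: the bad class inside `#¬aff-deep + #off`. [this file] -/
theorem card_compl_goodSet_le {ρ₁ ε₁ θ δ : ℝ} (y : Fin N → E3) :
    ((goodSet ρ₁ ε₁ θ δ y)ᶜ).card ≤ notAffDeepCount ρ₁ ε₁ θ (1 / 450) y + offCount δ 2 y := by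
  simp only [notAffDeepCount, offCount, Nat.card_eq_fintype_card, Fintype.card_subtype]
  calc ((goodSet ρ₁ ε₁ θ δ y)ᶜ).card
      ≤ ((Finset.univ.filter fun i => ¬ AffDeepReg ρ₁ ε₁ θ (1 / 450) y i) ∪
          Finset.univ.filter fun i => ¬ InWindow δ 2 y i).card := by
        apply Finset.card_le_card
        intro i hi
        rw [Finset.mem_compl, goodSet, Finset.mem_filter, not_and] at hi
        rw [Finset.mem_union, Finset.mem_filter, Finset.mem_filter]
        by_cases hD : AffDeepReg ρ₁ ε₁ θ (1 / 450) y i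
        · exact Or.inr ⟨Finset.mem_univ _, fun hW => hi (Finset.mem_univ _) ⟨hD, hW⟩⟩
        · exact Or.inl ⟨Finset.mem_univ _, hD⟩
    _ ≤ _ := Finset.card_union_le _ _

/-! ## §2  Layer 3: the two pieces beneath B_aff -/

/-- **D · `DefectPairFloor`** (TRUE-type · ATTACKABLE-S/M; registration-free).  For every `δ > 0` there is `C ≥ 0` such that for every
injective configuration and every index class `B` whose COMPLEMENT is `δ`-separated (`nearestDist ≥ δ` off `B`), the pairs touching `B` —
all ordered pairs from `B`, plus the pairs from `Bᶜ` into `B` — sum to `≥ −2C·#B`.  Proof route: `pairSum B B = 2·𝓔(y|_B) ≥ −2 C_LJ #B`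
(LJ stability, `lennardJones_stable`); for `i ∈ B` the sites of `Bᶜ` are `δ`-separated, so `∑_{j ∉ B} V⁻(|y i − y j|) ≤ C(δ)` by shell
counting with `V ≥ −1/12`, `V ≥ −r⁻⁶/6`. [BlancLewin2015 §1.3 (10),(12)] -/
def DefectPairFloor : Prop :=
  ∀ δ : ℝ, 0 < δ → ∃ C : ℝ, 0 ≤ C ∧ ∀ (N : ℕ) (y : Fin N → E3), Function.Injective y → ∀ B : Finset (Fin N),
    (∀ i : Fin N, i ∉ B → δ ≤ nearestDist y i) → -(C * (B.card : ℝ)) ≤ 1 / 2 * (pairSum B Finset.univ y + pairSum Bᶜ B y)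

/-- **G · `GoodCoreFloor R ρ₁ θ`** (TRUE-type · ATTACKABLE-L; the localised fine leaf).  Given K_bent and R_aff: for some `ε₀ > 0`, every
fine residual `ε₁ ≤ ε₀` and every window `[δ, 2]`, the good class's internal pair energy exceeds its (free) floor `e⋆·#G` by `c > 0` per
scale-bad good site, up to `C` per bad site: `#G·e⋆ + c·#(G ∩ scale-bad) − C·#Gᶜ ≤ ½·pairSum G G`.  Split: §3. -/
def GoodCoreFloor (R ρ₁ θ : ℝ) : Prop :=
  BentReferenceStability R → AffineChartStraightening →
    ∃ ε₀ : ℝ, 0 < ε₀ ∧ ∀ ε₁ : ℝ, 0 < ε₁ → ε₁ ≤ ε₀ → ∀ δ : ℝ, 0 < δ → δ ≤ 2 →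
      ∃ c C : ℝ, 0 < c ∧ 0 ≤ C ∧ ∀ (N : ℕ) (y : Fin N → E3), Function.Injective y →
        ((goodSet ρ₁ ε₁ θ δ y).card : ℝ) * (⨅ Q : PeriodicConfiguration 3, Q.energyPerParticle lennardJones)
          + c * ((goodScaleBadSet ρ₁ ε₁ θ δ y).card : ℝ) - C * (((goodSet ρ₁ ε₁ θ δ y)ᶜ).card : ℝ)
          ≤ 1 / 2 * pairSum (goodSet ρ₁ ε₁ θ δ y) (goodSet ρ₁ ε₁ θ δ y) y

/-- **LAYER-3 SEAM (PROVED): `DefectPairFloor → GoodCoreFloor R ρ₁ θ → HarmonicReductionAff R ρ₁ θ`.**  Exact bookkeeping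
`2𝓔 = pairSum G G + (pairSum Gᶜ univ + pairSum G Gᶜ)`, the two floors, `#G + #Gᶜ = N`, and the two counting lemmas of §1; the leaf's
`N^{2/3}` and gain rebates are not used (`u := e0`). [this file] -/
theorem harmonicReductionAff_of_defectPair_goodCore {R ρ₁ θ : ℝ} (hD : DefectPairFloor) (hG : GoodCoreFloor R ρ₁ θ) :
    HarmonicReductionAff R ρ₁ θ := by
  intro hKb hR
  obtain ⟨ε₀, hε₀, hG'⟩ := hG hKb hR
  refine ⟨ε₀, hε₀, fun δ hδ hδ2 => ?_⟩
  obtain ⟨CD, hCD0, hD'⟩ := hD δ hδ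
  obtain ⟨c, C, hc, hC0, hG''⟩ := hG' ε₀ hε₀ le_rfl δ hδ hδ2
  refine ⟨c, C + CD + |⨅ Q : PeriodicConfiguration 3, Q.energyPerParticle lennardJones| + c, hc, fun N y hy => ⟨e0, norm_e0, ?_⟩⟩
  set es : ℝ := ⨅ Q : PeriodicConfiguration 3, Q.energyPerParticle lennardJones with hes
  set G : Finset (Fin N) := goodSet ρ₁ ε₀ θ δ y with hGdef
  have h1 := hG'' N y hy
  have h2 := hD' N y hy Gᶜ fun i hi => le_nearestDist_of_not_mem_compl_goodSet hi
  rw [compl_compl] at h2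
  have hE : 2 * interactionEnergy lennardJones y = pairSum G G y + (pairSum Gᶜ Finset.univ y + pairSum G Gᶜ y) := by
    rw [two_mul_interactionEnergy_eq_pairSum, pairSum_univ_left G, pairSum_univ_right G G]
    ring
  have hN : ((G.card : ℝ) + ((Gᶜ).card : ℝ)) = N := by
    have := Finset.card_add_card_compl G
    rw [Fintype.card_fin] at this
    exact_mod_cast this
  have hc1 : (affRegScaleCount (122 / 125) 0 ρ₁ ε₀ θ (1 / 450) y : ℝ) ≤ (goodScaleBadSet ρ₁ ε₀ θ δ y).card + offCount δ 2 y := by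
    exact_mod_cast affRegScaleCount_le_goodScaleBad_add_off y
  have hc2 : (((Gᶜ).card : ℕ) : ℝ) ≤ notAffDeepCount ρ₁ ε₀ θ (1 / 450) y + offCount δ 2 y := by
    exact_mod_cast card_compl_goodSet_le y
  have n1 : (0 : ℝ) ≤ (Gᶜ).card := Nat.cast_nonneg _
  have n2 : (0 : ℝ) ≤ offCount δ 2 y := Nat.cast_nonneg _
  have n3 : (0 : ℝ) ≤ notAffDeepCount ρ₁ ε₀ θ (1 / 450) y := Nat.cast_nonneg _
  have n4 : (0 : ℝ) ≤ (N : ℝ) ^ (2 / 3 : ℝ) := Real.rpow_nonneg (Nat.cast_nonneg _) _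
  have n5 : 0 ≤ dilGain y + shGain e0 y := add_nonneg (dilGain_nonneg y) (shGain_nonneg _ y)
  have hab : es * ((Gᶜ).card : ℝ) ≤ |es| * ((Gᶜ).card : ℝ) := mul_le_mul_of_nonneg_right (le_abs_self es) n1
  have habs : 0 ≤ |es| := abs_nonneg es
  have hK0 : 0 ≤ C + CD + |es| + c := by linarith
  have s1 : (N : ℝ) * es ≤ (G.card : ℝ) * es + |es| * ((Gᶜ).card : ℝ) := by
    have : (N : ℝ) * es = (G.card : ℝ) * es + es * ((Gᶜ).card : ℝ) := by rw [← hN]; ring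
    linarith
  have s2 := mul_le_mul_of_nonneg_left hc1 hc.le
  have s3 := mul_le_mul_of_nonneg_left hc2 hK0
  rw [mul_add] at s2 s3
  have s4 : 0 ≤ (C + CD + |es| + c) * (N : ℝ) ^ (2 / 3 : ℝ) := mul_nonneg hK0 n4
  have s5 : 0 ≤ (C + CD + |es| + c) * (dilGain y + shGain e0 y) := mul_nonneg hK0 n5
  have s6 : 0 ≤ c * (notAffDeepCount ρ₁ ε₀ θ (1 / 450) y : ℝ) := mul_nonneg hc.le n3
  have s7 : (C + CD + |es| + c) * (((Gᶜ).card : ℕ) : ℝ) = C * ((Gᶜ).card : ℝ) + CD * ((Gᶜ).card : ℝ) + |es| * ((Gᶜ).card : ℝ)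
      + c * ((Gᶜ).card : ℝ) := by ring
  have s8 : (offCount δ 2 y : ℝ) ≤ ((Gᶜ).card : ℝ) := by
    have : offCount δ 2 y ≤ (Gᶜ).card := by
      simp only [offCount, Nat.card_eq_fintype_card, Fintype.card_subtype]
      apply Finset.card_le_card
      intro i hi
      rw [Finset.mem_filter] at hi
      rw [Finset.mem_compl, hGdef, goodSet, Finset.mem_filter, not_and]
      exact fun _ h => hi.2 h.2
    exact_mod_cast this
  linarith [h1, h2, hE, s1, s2, s3, s4, s5, s6, s7, s8, mul_le_mul_of_nonneg_left s8 hc.le]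

/-! ## §3  Layer 4: the NEAR / FAR regime split of the good class -/

/-- **The NEAR class** at threshold `θ₀`: good, affinely framed at residual `ε₁` by a chart `θ₀`-CLOSE TO A SIMILARITY, and not scale-bad.
Zero census budget; treated by the harmonic expansion about the site's own affine chart. -/
noncomputable def nearSet (θ₀ ρ₁ ε₁ θ δ : ℝ) (y : Fin N → E3) : Finset (Fin N) :=
  (goodSet ρ₁ ε₁ θ δ y).filter fun i => AffFramed ε₁ θ₀ (1 / 450) y i ∧
    ¬ (Bad (122 / 125) 0 y i ∧ (Short (122 / 125) 0 y i ∨ Long (122 / 125) 0 y i))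

/-- **The FAR class**: good but not near — every affine frame at residual `ε₁` is `≥ θ₀`-far from the similarities, or the site is
scale-bad; true excess `≥ c_W θ₀²` resp. `≥ e_iso` per site (Cauchy–Born coercivity of the polytype equation of state). -/
noncomputable def farSet (θ₀ ρ₁ ε₁ θ δ : ℝ) (y : Fin N → E3) : Finset (Fin N) :=
  (goodSet ρ₁ ε₁ θ δ y).filter fun i => ¬ (AffFramed ε₁ θ₀ (1 / 450) y i ∧
    ¬ (Bad (122 / 125) 0 y i ∧ (Short (122 / 125) 0 y i ∨ Long (122 / 125) 0 y i)))

/-- **N · `NearClusterFloor R ρ₁ θ θ₀ κ`** (TRUE-type · ATTACKABLE-L; the harmonic piece).  Given K_bent and R_aff: for some `ε₀ > 0`,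
all `ε₁ ≤ ε₀`, all windows: `#Near·e⋆ − C·#Gᶜ − κ·#Far ≤ ½·pairSum Near G` — the near class's half-bonds into good matter are floored
at `e⋆` per near site, up to `C` per bad site (walls, free surfaces: every omitted bond of a near site is attractive since its length is
`≥ nearestDist ≥ 0.956·(122/125) > 2^{-1/6}`) and `κ` per far site (transition flux `O(ε₁)` per bond; same-grain tail exchange beyond the
Taylor range `r_T = ε₁^{-1/2}`: `≤ (πρ⋆/18) r_T⁻³ = 0.27 ε₁^{3/2}`).  Internal budgets: memo §4 (zeroth order exact; internal-mode square
completion against K; K_bent along `Z_t`; hessian tail `0.16 C` at `R = 3`). -/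
def NearClusterFloor (R ρ₁ θ θ₀ κ : ℝ) : Prop :=
  BentReferenceStability R → AffineChartStraightening →
    ∃ ε₀ : ℝ, 0 < ε₀ ∧ ∀ ε₁ : ℝ, 0 < ε₁ → ε₁ ≤ ε₀ → ∀ δ : ℝ, 0 < δ → δ ≤ 2 →
      ∃ C : ℝ, 0 ≤ C ∧ ∀ (N : ℕ) (y : Fin N → E3), Function.Injective y →
        ((nearSet θ₀ ρ₁ ε₁ θ δ y).card : ℝ) * (⨅ Q : PeriodicConfiguration 3, Q.energyPerParticle lennardJones)
          - C * (((goodSet ρ₁ ε₁ θ δ y)ᶜ).card : ℝ) - κ * ((farSet θ₀ ρ₁ ε₁ θ δ y).card : ℝ)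
          ≤ 1 / 2 * pairSum (nearSet θ₀ ρ₁ ε₁ θ δ y) (goodSet ρ₁ ε₁ θ δ y) y

/-- **Z · `FarAggregatePricing ρ₁ θ θ₀ κ`** (TRUE-type · ATTACKABLE-M + CERT; the coercivity piece).  Given R_aff: for some `ε₀ > 0`, all
`ε₁ ≤ ε₀`, all windows, some `c > 0`, `C`: `#Far·(e⋆ + κ) + c·#(G ∩ scale-bad) − C·#Gᶜ ≤ ½·pairSum Far G` — each far site's half-bonds into
good matter are worth `≥ W(A_x) − O(ε₁) − (tail exchange)`, and `W(A_x) − e⋆ ≥ c_W θ₀²` (shear `≥ θ₀/√2` from every similarity) or `≥ e_iso`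
(scale-bad) pays `κ`, the `O(ε₁)` losses and the census price; `G ∩ scale-bad ⊆ Far` by definition.  The equation-of-state input
(`W_s(A) − e⋆ ≥ c_W · dist(A, SO(3)·d⋆-similarities)²` near the well, `≥ e_iso` outside, layer-averaged over Hägg words) is CERT. -/
def FarAggregatePricing (ρ₁ θ θ₀ κ : ℝ) : Prop :=
  AffineChartStraightening →
    ∃ ε₀ : ℝ, 0 < ε₀ ∧ ∀ ε₁ : ℝ, 0 < ε₁ → ε₁ ≤ ε₀ → ∀ δ : ℝ, 0 < δ → δ ≤ 2 →
      ∃ c C : ℝ, 0 < c ∧ 0 ≤ C ∧ ∀ (N : ℕ) (y : Fin N → E3), Function.Injective y →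
        ((farSet θ₀ ρ₁ ε₁ θ δ y).card : ℝ) * (⨅ Q : PeriodicConfiguration 3, Q.energyPerParticle lennardJones)
          + κ * ((farSet θ₀ ρ₁ ε₁ θ δ y).card : ℝ) + c * ((goodScaleBadSet ρ₁ ε₁ θ δ y).card : ℝ)
          - C * (((goodSet ρ₁ ε₁ θ δ y)ᶜ).card : ℝ)
          ≤ 1 / 2 * pairSum (farSet θ₀ ρ₁ ε₁ θ δ y) (goodSet ρ₁ ε₁ θ δ y) y

/-- **LAYER-4 SEAM (PROVED): `NearClusterFloor R ρ₁ θ θ₀ κ → FarAggregatePricing ρ₁ θ θ₀ κ → GoodCoreFloor R ρ₁ θ`** —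
`pairSum G G = pairSum Near G + pairSum Far G`, `#Near + #Far = #G`, addition (the `κ·#Far` transfer cancels). [this file] -/
theorem goodCoreFloor_of_near_far {R ρ₁ θ θ₀ κ : ℝ} (hN : NearClusterFloor R ρ₁ θ θ₀ κ) (hZ : FarAggregatePricing ρ₁ θ θ₀ κ) :
    GoodCoreFloor R ρ₁ θ := by
  intro hKb hR
  obtain ⟨ε₀, hε₀, hN'⟩ := hN hKb hR
  obtain ⟨ε₀', hε₀', hZ'⟩ := hZ hR
  refine ⟨min ε₀ ε₀', lt_min hε₀ hε₀', fun ε₁ hε₁ hε₁le δ hδ hδ2 => ?_⟩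
  obtain ⟨CN, hCN0, hN''⟩ := hN' ε₁ hε₁ (hε₁le.trans (min_le_left _ _)) δ hδ hδ2
  obtain ⟨c, CZ, hc, hCZ0, hZ''⟩ := hZ' ε₁ hε₁ (hε₁le.trans (min_le_right _ _)) δ hδ hδ2
  refine ⟨c, CN + CZ, hc, add_nonneg hCN0 hCZ0, fun N y hy => ?_⟩
  have h1 := hN'' N y hy
  have h2 := hZ'' N y hy
  have hsplit : pairSum (goodSet ρ₁ ε₁ θ δ y) (goodSet ρ₁ ε₁ θ δ y) y =
      pairSum (nearSet θ₀ ρ₁ ε₁ θ δ y) (goodSet ρ₁ ε₁ θ δ y) y + pairSum (farSet θ₀ ρ₁ ε₁ θ δ y) (goodSet ρ₁ ε₁ θ δ y) y := by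
    unfold pairSum nearSet farSet
    rw [Finset.sum_filter_add_sum_filter_not]
  have hcard : ((nearSet θ₀ ρ₁ ε₁ θ δ y).card : ℝ) + ((farSet θ₀ ρ₁ ε₁ θ δ y).card : ℝ) = (goodSet ρ₁ ε₁ θ δ y).card := by
    have := Finset.card_filter_add_card_filter_not
      (s := goodSet ρ₁ ε₁ θ δ y) (fun i => AffFramed ε₁ θ₀ (1 / 450) y i ∧
        ¬ (Bad (122 / 125) 0 y i ∧ (Short (122 / 125) 0 y i ∨ Long (122 / 125) 0 y i)))
    unfold nearSet farSet
    exact_mod_cast this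
  have hce : ((nearSet θ₀ ρ₁ ε₁ θ δ y).card : ℝ) * (⨅ Q : PeriodicConfiguration 3, Q.energyPerParticle lennardJones)
      + ((farSet θ₀ ρ₁ ε₁ θ δ y).card : ℝ) * (⨅ Q : PeriodicConfiguration 3, Q.energyPerParticle lennardJones)
      = ((goodSet ρ₁ ε₁ θ δ y).card : ℝ) * (⨅ Q : PeriodicConfiguration 3, Q.energyPerParticle lennardJones) := by
    rw [← hcard]; ring
  rw [hsplit]
  linarith [h1, h2, hce]

/-! ## §4  Record layer-3/4 composition beneath B_aff -/

/-- **B_aff from the three leaves (PROVED):** `DefectPairFloor → NearClusterFloor R ρ₁ θ θ₀ κ → FarAggregatePricing ρ₁ θ θ₀ κ →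
HarmonicReductionAff R ρ₁ θ`. [this file] -/
theorem harmonicReductionAff_of_defectPair_near_far {R ρ₁ θ θ₀ κ : ℝ} (hD : DefectPairFloor) (hN : NearClusterFloor R ρ₁ θ θ₀ κ)
    (hZ : FarAggregatePricing ρ₁ θ θ₀ κ) : HarmonicReductionAff R ρ₁ θ :=
  harmonicReductionAff_of_defectPair_goodCore hD (goodCoreFloor_of_near_far hN hZ)

/-! ## §5  CONES (PROVED compositions) -/

/-- **CONE LI (slot 3 fully split along the affine harmonic line).**
`K_bent R → R_aff → D → N(R, ρ₁, θ, θ₀, κ) → Z(ρ₁, θ, θ₀, κ) → AffMidAll ρ₁ θ → TBDSG`. [this file] -/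
theorem tbdsg_of_affineLocalisation (R ρ₁ θ θ₀ κ : ℝ) (hKb : BentReferenceStability R) (hR : AffineChartStraightening)
    (hD : DefectPairFloor) (hN : NearClusterFloor R ρ₁ θ θ₀ κ) (hZ : FarAggregatePricing ρ₁ θ θ₀ κ) (hM : AffMidAll ρ₁ θ) :
    TameBalancedDeepScaleGap (122 / 125) 0 4 (3 / 50) (1 / 450) :=
  tbdsg_of_bentAff_midAllAff R ρ₁ θ hKb hR (harmonicReductionAff_of_defectPair_near_far hD hN hZ) hM

/-- **CONE LI at the record literals** `R = 3`, `ρ₁ = 12`, `θ = 1/25`, `θ₀ = 1/1000`, `κ = 1/10⁶`. [this file] -/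
theorem tbdsg_of_affineLocalisation_record (hKb : BentReferenceStability 3) (hR : AffineChartStraightening) (hD : DefectPairFloor)
    (hN : NearClusterFloor 3 12 (1 / 25) (1 / 1000) (1 / 10 ^ 6)) (hZ : FarAggregatePricing 12 (1 / 25) (1 / 1000) (1 / 10 ^ 6))
    (hM : AffMidAll 12 (1 / 25)) : TameBalancedDeepScaleGap (122 / 125) 0 4 (3 / 50) (1 / 450) :=
  tbdsg_of_affineLocalisation 3 12 (1 / 25) (1 / 1000) (1 / 10 ^ 6) hKb hR hD hN hZ hM

/-- **RDEF CONE LI (eleven slots)** — cone XLVI with slot 3 replaced by the affine harmonic line: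
`ChargedEnergyGap → TwoShellShape (1/100) (3/50) (1/450) → K_bent R → R_aff → D → N → Z → AffMidAll ρ₁ θ → CleanlessExcessT →
CoherentResidual 10 → RobustDefectLimitWindows`. [this file] -/
theorem rdef_of_ceg_shape_affineLocalisation (R ρ₁ θ θ₀ κ : ℝ) (hCEG : ChargedEnergyGap)
    (hT : TwoShellShape (1 / 100) (3 / 50) (1 / 450)) (hKb : BentReferenceStability R) (hR : AffineChartStraightening)
    (hD : DefectPairFloor) (hN : NearClusterFloor R ρ₁ θ θ₀ κ) (hZ : FarAggregatePricing ρ₁ θ θ₀ κ) (hM : AffMidAll ρ₁ θ)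
    (hCE : CleanlessExcessT) (hRes : CoherentResidual 10) : RobustDefectLimitWindows :=
  rdef_of_ceg_shape_balancedDeep_record hCEG hT (tbdsg_of_affineLocalisation R ρ₁ θ θ₀ κ hKb hR hD hN hZ hM) hCE hRes

end Summit.AtomisticToContinuum.Crystallization.Theorems.OverbindingBudgetAffineLocalisation
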